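import Summits.QuantumFields.BalabanUV.T4Continuum.Support.ShellMeasureGradientPinnedDecay
import Summits.QuantumFields.BalabanUV.T4Continuum.Support.ShellMeasurePinnedNormEta
import Summits.QuantumFields.BalabanUV.T4Continuum.Support.ShellMeasurePinnedProp4Weighted

/-!
# `T4Continuum.ShellMeasureGradientPinnedDecayLevels` — GP-D AT THE LIVE LEVELS: the η-FREE torus instance and the
# `WMax`-WEIGHTED twin of «the (P4) letter is pinned-quadratic by decay» (row S84 file 2; v1.1 = v1 p228593 + §3b toy, G-1)
(cell `pub-balaban`, `t4`, NE7c (node U5b); crew seat `b2b-balaban-t4-ne7c-formalise-leaf-06` gen 6; owner g32 GO l.17772 ∕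
l.18069; imports S84 f1 `ShellMeasureGradientPinnedDecay`, S79 `ShellMeasurePinnedNormEta`, S75 f2 `ShellMeasurePinnedProp4Weighted`
ONLY; [folklore]; 0 `def`, 0 `def … : Prop`, 0 sorry, 0 citation.)  HONEST FRAMING: finite T⁴, rung (B)+1 only — NOT
infinite volume, NOT mass gap, NOT Clay; NE7c NOT PRINTED, NOT PROVED, «NE7c ⇐ the named binders» (c3); operator-norm
PLUMBING on OUR side; every derivative-kernel decay display below is a BINDER of (73)∘(46) TYPE ([Balaban1985Variational]
(73), [Balaban1984PropagatorsI] (46) — LOCATORS), NOT asserted, NOT discharged.  HONEST DEPENDENCY (cell): continuum YM on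
T⁴ ⇐ BetaPertH ∧ nine spine estimates (0/9 proved); BetaPertH ⇐ (D1) ∧ (D4) ∧ CAP+tail; G-an2-4 gates asym, D1 and NE2/3/4.
THE POINT.  S84 f1's `Prop4Hyp D_pin (c₀·M) r` (ONE display `‖dker D A c b‖ ≤ c₀‖A‖e^{−δρ}`) under two live-level
guard-rails: (γ4, S79) η-FREE constants (cell volume in the entry, PHYSICAL decay) — §1 `…_eta` ∕ `…_fineRate`; and
(F-ne7cp1-g31-1, S75 f2, leaf-02-g8 l.17739) the SAME pinned `WMax` source — §2 `…_weighted_of_entry_decay` (+ `_fineRate`,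
the `Prop4Hyp.add` partner of S77's `…_torusPin`, vacuous as typed until S77 f6 — F-ne7cleaf02g9-1); §3 toys (rule G-1).
NOT HERE: the display for OUR `termsHD` ([T] W-a∕W-h), [dict].  NOTHING in the countdown moves; spine PROVED 0∕9.
-/

noncomputable section

open Metric Set Function Filter
open scoped Topology

namespace Summit.QuantumFields.BalabanUV.T4Continuum.ShellMeasureGradientPinnedDecayLevels

open Literature.MathematicalPhysics.QuantumFieldTheory.Balaban1983to89
open B11Prop6Scheme (Prop4Hyp)
open TreeLengthTorus (TPt)
open B12Decay510Torus (pl1)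
open Summit.QuantumFields.BalabanUV.T4Continuum.ShellMeasureMultiGridNorms (WSup)
open Summit.QuantumFields.BalabanUV.T4Continuum.ShellMeasureMultiGridNormsMax (WMax)
open B12Decay510Window (K₁ K₁_nonneg)
open Summit.QuantumFields.BalabanUV.T4Continuum.ShellMeasureMultiGridNormsMax (Prop4Hyp.mono)
open Summit.QuantumFields.BalabanUV.T4Continuum.ShellMeasurePinnedNorm (pinW pinW_apply kerOpPin pinDist pinDist_nonneg pinDist_le_add)
open Summit.QuantumFields.BalabanUV.T4Continuum.ShellMeasurePinnedNormEta
  (opNorm_kerOpPin_eta_le opNorm_kerOpPin_fineRate_le eta_pow_mul_K₁_le)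
open Summit.QuantumFields.BalabanUV.T4Continuum.ShellMeasureDecayKernelSums (kerOp kerOp_apply sum_exp_pl1_comp_le)
open Summit.QuantumFields.BalabanUV.T4Continuum.ShellMeasureDecayKernelTail (dker dker_apply kerOp_dker)
open Summit.QuantumFields.BalabanUV.T4Continuum.ShellMeasurePinnedProp4Weighted (norm_field_le norm_unpin_le)
open Summit.QuantumFields.BalabanUV.T4Continuum.ShellMeasureGradientPinnedDecay (prop4Hyp_pinned_of_kerOpPin_dker_le)

variable {Λ Λ' : Type*} [Fintype Λ] [Fintype Λ'] [DecidableEq Λ] {𝔄 𝔅 : Type*} [NormedAddCommGroup 𝔄]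
  [NormedSpace ℂ 𝔄] [NormedAddCommGroup 𝔅] [NormedSpace ℂ 𝔅]

/-! ## §1 (γ4) The η-free torus instance -/

section Eta

variable {d T : ℕ} [NeZero T] (posIn : Λ → TPt d T) (posOut : Λ' → TPt d T) (B₀ : Finset (TPt d T))
  (hB₀ : B₀.Nonempty)

/-- **GP-D ON THE FINE TORUS, η-FREE (γ4).**  `D : (Λ → 𝔄) → (Λ′ → 𝔅)` differentiable on the flat `ball 0 r`, `D 0 = 0`;
indices placed on `(ℤ∕Tℤ)^d` by `pos`∕`pos′` with at most `m` input indices per fine site; ONE display with the CELL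
VOLUME in the entry and decay in PHYSICAL distance, linear in the flat size —
`‖dker D A c b‖ ≤ c₀·η^d·‖A‖·e^{−δ·η·pl1(pos′ c − pos b)}` on the ball ((73)∘(46) TYPE, NOT asserted); the PHYSICAL pin
`ϖ = η·pinDist B₀` to ANY nonempty reference set `B₀`; `0 ≤ δ′ < δ`, `0 < η ≤ 1`, `1 ≤ d`.  Then
`Prop4Hyp D_pin (c₀·m·(2(d + (δ−δ′))∕(δ−δ′))^d) r` — NO `η`, NO `T`, NO `#B₀` in the constant (S84 f1 §1 fired on
S79 `opNorm_kerOpPin_eta_le` at density `c₀‖A‖`). [folklore] -/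
theorem prop4Hyp_pinned_of_entry_decay_eta {m : ℕ} (hm : ∀ x, (Finset.univ.filter fun b => posIn b = x).card ≤ m)
    (hd : 0 < d) {D : (Λ → 𝔄) → (Λ' → 𝔅)} {r c₀ δ δ' η : ℝ} (hc₀ : 0 ≤ c₀) (hδ' : 0 ≤ δ') (hδ : δ' < δ)
    (hη : 0 < η) (hη1 : η ≤ 1) (hD : DifferentiableOn ℂ D (ball 0 r)) (hD0 : D 0 = 0)
    (hdec : ∀ A ∈ ball (0 : Λ → 𝔄) r, ∀ c b,
      ‖dker D A c b‖ ≤ c₀ * η ^ d * ‖A‖ * Real.exp (-(δ * (η * pl1 (posOut c - posIn b))))) :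
    Prop4Hyp (fun Y : WSup (pinW δ' ((fun x => η * pinDist B₀ hB₀ x) ∘ posIn)) 1 𝔄 =>
        ((WSup.toPiL (pinW δ' ((fun x => η * pinDist B₀ hB₀ x) ∘ posOut)) 1).symm
          (D (WSup.toPiL (pinW δ' ((fun x => η * pinDist B₀ hB₀ x) ∘ posIn)) 1 Y)) :
            WSup (pinW δ' ((fun x => η * pinDist B₀ hB₀ x) ∘ posOut)) 1 𝔅))
      (c₀ * (m * (2 * (d + (δ - δ')) / (δ - δ')) ^ d)) r := by
  have hK : 0 ≤ c₀ * (m * (2 * (d + (δ - δ')) / (δ - δ')) ^ d) := by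
    have : 0 < δ - δ' := by linarith
    positivity
  refine prop4Hyp_pinned_of_kerOpPin_dker_le δ' _ _ hK hδ'
    (fun b => mul_nonneg hη.le (pinDist_nonneg B₀ hB₀ (posIn b))) hD hD0 fun A hA => ?_
  have h := opNorm_kerOpPin_eta_le (dker D A) posIn posOut B₀ hB₀ hm hd (c₀ := c₀ * ‖A‖) (by positivity) hδ' hδ
    hη hη1 (fun c b => by
      calc ‖dker D A c b‖ ≤ c₀ * η ^ d * ‖A‖ * Real.exp (-(δ * (η * pl1 (posOut c - posIn b)))) := hdec A hA c b
        _ = c₀ * ‖A‖ * η ^ d * Real.exp (-(δ * (η * pl1 (posOut c - posIn b)))) := by ring)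
  calc _ ≤ c₀ * ‖A‖ * (m * (2 * (d + (δ - δ')) / (δ - δ')) ^ d) := h
    _ = c₀ * (m * (2 * (d + (δ - δ')) / (δ - δ')) ^ d) * ‖A‖ := by ring

/-- **THE FINE-RATE SPELLING** (pins `pinW (δ′η) (pinDist B₀ ∘ pos)`, kernel rate `δη` per fine step — the spelling of
S70 f1 ∕ S71 ∕ S74 f2): display `‖dker D A c b‖ ≤ c₀·η^d·‖A‖·e^{−(δη)·pl1(pos′ c − pos b)}` ⟹
`Prop4Hyp D_pin (c₀·m·(2(d + (δ−δ′))∕(δ−δ′))^d) r` at pin rate `δ′η` — the same η-free constant. [folklore] -/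
theorem prop4Hyp_pinned_of_entry_decay_fineRate {m : ℕ}
    (hm : ∀ x, (Finset.univ.filter fun b => posIn b = x).card ≤ m) (hd : 0 < d) {D : (Λ → 𝔄) → (Λ' → 𝔅)}
    {r c₀ δ δ' η : ℝ} (hc₀ : 0 ≤ c₀) (hδ' : 0 ≤ δ') (hδ : δ' < δ) (hη : 0 < η) (hη1 : η ≤ 1)
    (hD : DifferentiableOn ℂ D (ball 0 r)) (hD0 : D 0 = 0)
    (hdec : ∀ A ∈ ball (0 : Λ → 𝔄) r, ∀ c b,
      ‖dker D A c b‖ ≤ c₀ * η ^ d * ‖A‖ * Real.exp (-((δ * η) * pl1 (posOut c - posIn b)))) :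
    Prop4Hyp (fun Y : WSup (pinW (δ' * η) (pinDist B₀ hB₀ ∘ posIn)) 1 𝔄 =>
        ((WSup.toPiL (pinW (δ' * η) (pinDist B₀ hB₀ ∘ posOut)) 1).symm
          (D (WSup.toPiL (pinW (δ' * η) (pinDist B₀ hB₀ ∘ posIn)) 1 Y)) :
            WSup (pinW (δ' * η) (pinDist B₀ hB₀ ∘ posOut)) 1 𝔅))
      (c₀ * (m * (2 * (d + (δ - δ')) / (δ - δ')) ^ d)) r := by
  have hK : 0 ≤ c₀ * (m * (2 * (d + (δ - δ')) / (δ - δ')) ^ d) := by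
    have : 0 < δ - δ' := by linarith
    positivity
  refine prop4Hyp_pinned_of_kerOpPin_dker_le (δ' * η) _ _ hK (by positivity)
    (fun b => pinDist_nonneg B₀ hB₀ (posIn b)) hD hD0 fun A hA => ?_
  have h := opNorm_kerOpPin_fineRate_le (dker D A) posIn posOut B₀ hB₀ hm hd (c₀ := c₀ * ‖A‖) (by positivity) hδ'
    hδ hη hη1 (fun c b => by
      calc ‖dker D A c b‖ ≤ c₀ * η ^ d * ‖A‖ * Real.exp (-((δ * η) * pl1 (posOut c - posIn b))) := hdec A hA c b
        _ = c₀ * ‖A‖ * η ^ d * Real.exp (-((δ * η) * pl1 (posOut c - posIn b))) := by ring)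
  calc _ ≤ c₀ * ‖A‖ * (m * (2 * (d + (δ - δ')) / (δ - δ')) ^ d) := h
    _ = c₀ * (m * (2 * (d + (δ - δ')) / (δ - δ')) ^ d) * ‖A‖ := by ring

end Eta

/-! ## §2 The `WMax`-weighted twin: a pseudo-local letter on S75 f2's pinned source -/

section Weighted

variable {Λd : Type*} [Fintype Λd] {𝔇 : Type*} [NormedAddCommGroup 𝔇] [NormedSpace ℂ 𝔇]
variable (wt : Λ → ℝ) (wd : Λd → ℝ) (Dv : (Λ → 𝔄) →L[ℂ] (Λd → 𝔇)) [hwt : Fact (∀ b, 0 < wt b)]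
  [hwd : Fact (∀ b, 0 < wd b)] (v₀ : Λ' → ℝ) [hv₀ : Fact (∀ c, 0 < v₀ c)]
variable {S : Type*} (ρ : S → S → ℝ) (posIn : Λ → S) (posOut : Λ' → S) (ϖ : S → ℝ)

/-- **THE CONJUGATED DERIVATIVE IS BOUNDED BY THE WEIGHTED CONJUGATED ROW SUM.**  For a flat point `A` and a flat
derivative value `fderiv ℂ D A`, ONE weighted display `v₀ c·‖dker D A c b‖ ≤ c·wt b·e^{−δρ(pos′ c, pos b)}` (`0 ≤ c`), a
one-sided Lipschitz pin (`ϖ x ≤ ϖ y + ρ x y`), `0 ≤ δ′`, reduced-rate sums `Σ_b e^{−(δ−δ′)ρ(x, pos b)} ≤ M` (`0 ≤ M`) ⟹ for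
every `Y′` in S75 f2's pinned source `WMax (wt·pinW δ′ (ϖ∘pos)) wd Dv`:
`‖toPiL_out⁻¹ (DD(A)(toPiL_in Y′))‖_{WSup (v₀·pinW δ′ (ϖ∘pos′)) 1} ≤ c·M·‖Y′‖` (`DD(A) h = Σ_b dker D A · b (h b)`, S66 f3c
`kerOp_dker`; `e^{δ′ϖ c}·wt b‖Y′ b‖ ≤ e^{δ′ρ(c,b)}·‖Y′‖_pin`, S75 f2 `norm_field_le`). [folklore] -/
theorem norm_pin_fderiv_apply_le_weighted {D : (Λ → 𝔄) → (Λ' → 𝔅)} (A : Λ → 𝔄) {c δ δ' M : ℝ} (hc : 0 ≤ c)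
    (hδ' : 0 ≤ δ') (hM0 : 0 ≤ M) (hϖ : ∀ x y, ϖ x ≤ ϖ y + ρ x y)
    (hM : ∀ x : S, ∑ b, Real.exp (-((δ - δ') * ρ x (posIn b))) ≤ M)
    (hdec : ∀ c' b, v₀ c' * ‖dker D A c' b‖ ≤ c * wt b * Real.exp (-(δ * ρ (posOut c') (posIn b))))
    (Y' : WMax (fun b => wt b * pinW δ' (ϖ ∘ posIn) b) wd Dv) :
    ‖((WSup.toPiL (fun c' => v₀ c' * pinW δ' (ϖ ∘ posOut) c') 1).symm
        (fderiv ℂ D A (WMax.toPiL (fun b => wt b * pinW δ' (ϖ ∘ posIn) b) wd Dv Y')) :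
          WSup (fun c' => v₀ c' * pinW δ' (ϖ ∘ posOut) c') 1 𝔅)‖ ≤ c * M * ‖Y'‖ := by
  have hYn : 0 ≤ ‖Y'‖ := norm_nonneg _
  refine (WSup.norm_le_iff (fun c' => v₀ c' * pinW δ' (ϖ ∘ posOut) c') 1 (by positivity)).2 fun c' => ?_
  rw [pow_one, WSup.toPiL_symm_apply, pinW_apply, comp_apply]
  set h : Λ → 𝔄 := WMax.toPiL (fun b => wt b * pinW δ' (ϖ ∘ posIn) b) wd Dv Y' with hh
  have hhb : ∀ b, h b = Y' b := fun _ => rfl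
  -- the kernel form of the derivative
  have hsum : fderiv ℂ D A h c' = ∑ b, dker D A c' b (h b) := by
    rw [← kerOp_dker D A, kerOp_apply]
  rw [hsum]
  -- term by term
  have hterm : ∀ b, v₀ c' * Real.exp (δ' * ϖ (posOut c')) * ‖dker D A c' b (h b)‖ ≤
      c * Real.exp (-((δ - δ') * ρ (posOut c') (posIn b))) * ‖Y'‖ := fun b => by
    have h1 : ‖dker D A c' b (h b)‖ ≤ ‖dker D A c' b‖ * ‖Y' b‖ := by
      rw [hhb]; exact (dker D A c' b).le_opNorm _
    have h2 : Real.exp (δ' * ϖ (posOut c')) ≤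
        Real.exp (δ' * ρ (posOut c') (posIn b)) * Real.exp (δ' * ϖ (posIn b)) := by
      rw [← Real.exp_add]; exact Real.exp_le_exp.2 (by nlinarith [hϖ (posOut c') (posIn b)])
    have h3 := norm_field_le wt wd Dv δ' ϖ posIn Y' b
    have h4 : 0 ≤ wt b * ‖Y' b‖ := mul_nonneg (hwt.out b).le (norm_nonneg _)
    have hexp : Real.exp (-(δ * ρ (posOut c') (posIn b))) * Real.exp (δ' * ρ (posOut c') (posIn b)) =
        Real.exp (-((δ - δ') * ρ (posOut c') (posIn b))) := by
      rw [← Real.exp_add]; congr 1; ring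
    calc v₀ c' * Real.exp (δ' * ϖ (posOut c')) * ‖dker D A c' b (h b)‖
        ≤ v₀ c' * Real.exp (δ' * ϖ (posOut c')) * (‖dker D A c' b‖ * ‖Y' b‖) :=
          mul_le_mul_of_nonneg_left h1 (by have := hv₀.out c'; positivity)
      _ = (v₀ c' * ‖dker D A c' b‖) * (Real.exp (δ' * ϖ (posOut c')) * ‖Y' b‖) := by ring
      _ ≤ (c * wt b * Real.exp (-(δ * ρ (posOut c') (posIn b)))) *
            ((Real.exp (δ' * ρ (posOut c') (posIn b)) * Real.exp (δ' * ϖ (posIn b))) * ‖Y' b‖) :=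
          mul_le_mul (hdec c' b) (mul_le_mul_of_nonneg_right h2 (norm_nonneg _))
            (by positivity) (mul_nonneg (mul_nonneg hc (hwt.out b).le) (Real.exp_nonneg _))
      _ = c * (Real.exp (-(δ * ρ (posOut c') (posIn b))) * Real.exp (δ' * ρ (posOut c') (posIn b))) *
            (Real.exp (δ' * ϖ (posIn b)) * (wt b * ‖Y' b‖)) := by ring
      _ ≤ c * (Real.exp (-(δ * ρ (posOut c') (posIn b))) * Real.exp (δ' * ρ (posOut c') (posIn b))) * ‖Y'‖ :=
          mul_le_mul_of_nonneg_left h3 (by positivity)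
      _ = c * Real.exp (-((δ - δ') * ρ (posOut c') (posIn b))) * ‖Y'‖ := by rw [hexp]
  calc v₀ c' * Real.exp (δ' * ϖ (posOut c')) * ‖∑ b, dker D A c' b (h b)‖
      ≤ v₀ c' * Real.exp (δ' * ϖ (posOut c')) * ∑ b, ‖dker D A c' b (h b)‖ :=
        mul_le_mul_of_nonneg_left (norm_sum_le _ _) (by have := hv₀.out c'; positivity)
    _ = ∑ b, v₀ c' * Real.exp (δ' * ϖ (posOut c')) * ‖dker D A c' b (h b)‖ := by rw [Finset.mul_sum]
    _ ≤ ∑ b, c * Real.exp (-((δ - δ') * ρ (posOut c') (posIn b))) * ‖Y'‖ := Finset.sum_le_sum fun b _ => hterm b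
    _ = c * (∑ b, Real.exp (-((δ - δ') * ρ (posOut c') (posIn b)))) * ‖Y'‖ := by
        rw [Finset.mul_sum, Finset.sum_mul]
    _ ≤ c * M * ‖Y'‖ := by gcongr; exact hM (posOut c')

omit [DecidableEq Λ] in
/-- **CHAIN RULE THROUGH THE IDENTITIES (weighted).**  If `D` has flat derivative `𝔇` at `toPiL_in Y`, then
`Y ↦ toPiL_out⁻¹ (D (toPiL_in Y))` has derivative `toPiL_out⁻¹ ∘L 𝔇 ∘L toPiL_in` at `Y` from S75 f2's pinned `WMax` source to
the pinned target. [folklore] -/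
theorem hasFDerivAt_pin_weighted {D : (Λ → 𝔄) → (Λ' → 𝔅)} {δ' : ℝ}
    {Y : WMax (fun b => wt b * pinW δ' (ϖ ∘ posIn) b) wd Dv} {𝔇 : (Λ → 𝔄) →L[ℂ] (Λ' → 𝔅)}
    (hD : HasFDerivAt D 𝔇 (WMax.toPiL (fun b => wt b * pinW δ' (ϖ ∘ posIn) b) wd Dv Y)) :
    HasFDerivAt
      (fun Y : WMax (fun b => wt b * pinW δ' (ϖ ∘ posIn) b) wd Dv =>
        ((WSup.toPiL (fun c' => v₀ c' * pinW δ' (ϖ ∘ posOut) c') 1).symm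
          (D (WMax.toPiL (fun b => wt b * pinW δ' (ϖ ∘ posIn) b) wd Dv Y)) :
            WSup (fun c' => v₀ c' * pinW δ' (ϖ ∘ posOut) c') 1 𝔅))
      (((WSup.toPiL (𝔄 := 𝔅) (fun c' => v₀ c' * pinW δ' (ϖ ∘ posOut) c') 1).symm :
          (Λ' → 𝔅) →L[ℂ] WSup (fun c' => v₀ c' * pinW δ' (ϖ ∘ posOut) c') 1 𝔅).comp
        (𝔇.comp ((WMax.toPiL (fun b => wt b * pinW δ' (ϖ ∘ posIn) b) wd Dv :
          WMax (fun b => wt b * pinW δ' (ϖ ∘ posIn) b) wd Dv →L[ℂ] (Λ → 𝔄))))) Y :=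
  ((WSup.toPiL (𝔄 := 𝔅) (fun c' => v₀ c' * pinW δ' (ϖ ∘ posOut) c') 1).symm.hasFDerivAt).comp Y
    (hD.comp Y ((WMax.toPiL (fun b => wt b * pinW δ' (ϖ ∘ posIn) b) wd Dv).hasFDerivAt))

/-- **GP-D, `WMax`-WEIGHTED — A PSEUDO-LOCAL LETTER ON S75 f2's PINNED SOURCE.**  `D : (Λ → 𝔄) → (Λ′ → 𝔅)` with
`D 0 = 0` and S75 f2's flat differentiability clause `hWd` (on the UNPINNED `WMax wt wd Dv` ball of radius `r`); ONE
weighted derivative-kernel display READ AT THE `WMax` SIZE —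
`∀ Y : WMax wt wd Dv, ‖Y‖ < r → ∀ c b, v₀ c·‖dker D (toPiL Y) c b‖ ≤ c₀·‖Y‖·wt b·e^{−δρ(pos′ c, pos b)}` ((73)∘(46) TYPE in
the weighted currency, NOT asserted); a nonnegative one-sided Lipschitz pin (`0 ≤ ϖ`, `ϖ x ≤ ϖ y + ρ x y`), `0 ≤ δ′`,
reduced-rate sums `Σ_b e^{−(δ−δ′)ρ(x, pos b)} ≤ M`.  Then the letter read from `WMax (wt·pinW δ′ (ϖ∘pos)) wd Dv` to
`WSup (v₀·pinW δ′ (ϖ∘pos′)) 1 𝔅` satisfies `B11Prop6Scheme.Prop4Hyp … (c₀·M) r` — EXACTLY S75 f2's spaces, so it ADDS to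
S77's `prop4Hyp_pinned_ord₃_eta_levels` (S65 f2c `Prop4Hyp.add`).  Mean value on the CLOSED pinned ball of radius
`‖Y‖`; the unpinned copy has `‖·‖_WMax ≤ ‖·‖_pin` (S75 f2 `norm_unpin_le`).  Nothing printed is asserted; no estimate of
Bałaban's discharged. [folklore] -/
theorem prop4Hyp_pinned_weighted_of_entry_decay {D : (Λ → 𝔄) → (Λ' → 𝔅)} {r c₀ δ δ' M : ℝ} (hc₀ : 0 ≤ c₀)
    (hδ' : 0 ≤ δ') (hM0 : 0 ≤ M) (hϖ0 : ∀ x, 0 ≤ ϖ x) (hϖ : ∀ x y, ϖ x ≤ ϖ y + ρ x y)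
    (hM : ∀ x : S, ∑ b, Real.exp (-((δ - δ') * ρ x (posIn b))) ≤ M) (hD0 : D 0 = 0)
    (hWd : DifferentiableOn ℂ (fun Y : WMax wt wd Dv => D (WMax.toPiL wt wd Dv Y)) {Y | ‖Y‖ < r})
    (hdec : ∀ Y : WMax wt wd Dv, ‖Y‖ < r → ∀ c b,
      v₀ c * ‖dker D (WMax.toPiL wt wd Dv Y) c b‖ ≤ c₀ * ‖Y‖ * wt b * Real.exp (-(δ * ρ (posOut c) (posIn b)))) :
    Prop4Hyp (fun Y : WMax (fun b => wt b * pinW δ' (ϖ ∘ posIn) b) wd Dv =>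
        ((WSup.toPiL (fun c => v₀ c * pinW δ' (ϖ ∘ posOut) c) 1).symm
          (D (WMax.toPiL (fun b => wt b * pinW δ' (ϖ ∘ posIn) b) wd Dv Y)) :
            WSup (fun c => v₀ c * pinW δ' (ϖ ∘ posOut) c) 1 𝔅)) (c₀ * M) r := by
  -- the unpinned copy `ι Y` and its size
  set ι : WMax (fun b => wt b * pinW δ' (ϖ ∘ posIn) b) wd Dv → WMax wt wd Dv :=
    fun Y => (WMax.toPiL wt wd Dv).symm (WMax.toPiL (fun b => wt b * pinW δ' (ϖ ∘ posIn) b) wd Dv Y) with hι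
  have hιle : ∀ Y, ‖ι Y‖ ≤ ‖Y‖ := fun Y => norm_unpin_le wt wd Dv δ' ϖ posIn hδ' hϖ0 Y
  have hιpi : ∀ Y, WMax.toPiL wt wd Dv (ι Y) = WMax.toPiL (fun b => wt b * pinW δ' (ϖ ∘ posIn) b) wd Dv Y :=
    fun _ => rfl
  have hιd : Differentiable ℂ ι :=
    (WMax.toPiL wt wd Dv).symm.differentiable.comp
      (WMax.toPiL (fun b => wt b * pinW δ' (ϖ ∘ posIn) b) wd Dv).differentiable
  -- flat differentiability of `D` at the flat point of a pinned field of size `< r`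
  have hDflat : ∀ Y : WMax (fun b => wt b * pinW δ' (ϖ ∘ posIn) b) wd Dv, ‖Y‖ < r →
      HasFDerivAt D (fderiv ℂ D (WMax.toPiL (fun b => wt b * pinW δ' (ϖ ∘ posIn) b) wd Dv Y))
        (WMax.toPiL (fun b => wt b * pinW δ' (ϖ ∘ posIn) b) wd Dv Y) := fun Y hY => by
    have hιY : ι Y ∈ {Y : WMax wt wd Dv | ‖Y‖ < r} := (hιle Y).trans_lt hY
    have h1 : DifferentiableAt ℂ (fun Y : WMax wt wd Dv => D (WMax.toPiL wt wd Dv Y)) (ι Y) :=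
      (hWd _ hιY).differentiableAt ((isOpen_lt continuous_norm continuous_const).mem_nhds hιY)
    have h2 : DifferentiableAt ℂ
        ((fun Y : WMax wt wd Dv => D (WMax.toPiL wt wd Dv Y)) ∘ (WMax.toPiL wt wd Dv).symm)
        (WMax.toPiL wt wd Dv (ι Y)) := by
      refine DifferentiableAt.comp _ ?_ (WMax.toPiL wt wd Dv).symm.differentiableAt
      rw [(WMax.toPiL wt wd Dv).symm_apply_apply]; exact h1
    have e : ((fun Y : WMax wt wd Dv => D (WMax.toPiL wt wd Dv Y)) ∘ (WMax.toPiL wt wd Dv).symm) = D := by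
      funext A; simp only [comp_apply, ContinuousLinearEquiv.apply_symm_apply]
    rw [e, hιpi] at h2
    exact h2.hasFDerivAt
  refine { quad := fun Y hY => ?_, differentiableOn := ?_ }
  · -- mean value on the closed pinned ball of radius `‖Y‖`
    set s : Set (WMax (fun b => wt b * pinW δ' (ϖ ∘ posIn) b) wd Dv) := closedBall 0 ‖Y‖ with hs
    have hconv : Convex ℝ s := convex_closedBall _ _
    have hsY : ∀ Y' ∈ s, ‖Y'‖ < r := fun Y' hY' => (mem_closedBall_zero_iff.1 hY').trans_lt hY
    have hf : ∀ Y' ∈ s, HasFDerivWithinAt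
        (fun Y : WMax (fun b => wt b * pinW δ' (ϖ ∘ posIn) b) wd Dv =>
          ((WSup.toPiL (fun c => v₀ c * pinW δ' (ϖ ∘ posOut) c) 1).symm
            (D (WMax.toPiL (fun b => wt b * pinW δ' (ϖ ∘ posIn) b) wd Dv Y)) :
              WSup (fun c => v₀ c * pinW δ' (ϖ ∘ posOut) c) 1 𝔅))
        (((WSup.toPiL (𝔄 := 𝔅) (fun c' => v₀ c' * pinW δ' (ϖ ∘ posOut) c') 1).symm :
            (Λ' → 𝔅) →L[ℂ] WSup (fun c' => v₀ c' * pinW δ' (ϖ ∘ posOut) c') 1 𝔅).comp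
          ((fderiv ℂ D (WMax.toPiL (fun b => wt b * pinW δ' (ϖ ∘ posIn) b) wd Dv Y')).comp
            ((WMax.toPiL (fun b => wt b * pinW δ' (ϖ ∘ posIn) b) wd Dv :
              WMax (fun b => wt b * pinW δ' (ϖ ∘ posIn) b) wd Dv →L[ℂ] (Λ → 𝔄))))) s Y' := fun Y' hY' =>
      (hasFDerivAt_pin_weighted wt wd Dv v₀ posIn posOut ϖ (hDflat Y' (hsY Y' hY'))).hasFDerivWithinAt
    have hbound : ∀ Y' ∈ s,
        ‖((WSup.toPiL (𝔄 := 𝔅) (fun c' => v₀ c' * pinW δ' (ϖ ∘ posOut) c') 1).symm :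
            (Λ' → 𝔅) →L[ℂ] WSup (fun c' => v₀ c' * pinW δ' (ϖ ∘ posOut) c') 1 𝔅).comp
          ((fderiv ℂ D (WMax.toPiL (fun b => wt b * pinW δ' (ϖ ∘ posIn) b) wd Dv Y')).comp
            ((WMax.toPiL (fun b => wt b * pinW δ' (ϖ ∘ posIn) b) wd Dv :
              WMax (fun b => wt b * pinW δ' (ϖ ∘ posIn) b) wd Dv →L[ℂ] (Λ → 𝔄))))‖ ≤ c₀ * M * ‖Y‖ :=
      fun Y' hY' => by
      have hY'n : ‖Y'‖ ≤ ‖Y‖ := mem_closedBall_zero_iff.1 hY'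
      refine ContinuousLinearMap.opNorm_le_bound _ (by positivity) fun Z => ?_
      have h := norm_pin_fderiv_apply_le_weighted wt wd Dv v₀ ρ posIn posOut ϖ
        (WMax.toPiL (fun b => wt b * pinW δ' (ϖ ∘ posIn) b) wd Dv Y') (c := c₀ * ‖ι Y'‖) (by positivity) hδ' hM0
        hϖ hM (fun c' b => by
          have := hdec (ι Y') ((hιle Y').trans_lt (hsY Y' hY')) c' b
          calc v₀ c' * ‖dker D (WMax.toPiL (fun b => wt b * pinW δ' (ϖ ∘ posIn) b) wd Dv Y') c' b‖
              = v₀ c' * ‖dker D (WMax.toPiL wt wd Dv (ι Y')) c' b‖ := by rw [hιpi]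
            _ ≤ c₀ * ‖ι Y'‖ * wt b * Real.exp (-(δ * ρ (posOut c') (posIn b))) := this) Z
      calc _ = ‖((WSup.toPiL (fun c' => v₀ c' * pinW δ' (ϖ ∘ posOut) c') 1).symm
              (fderiv ℂ D (WMax.toPiL (fun b => wt b * pinW δ' (ϖ ∘ posIn) b) wd Dv Y')
                (WMax.toPiL (fun b => wt b * pinW δ' (ϖ ∘ posIn) b) wd Dv Z)) :
              WSup (fun c' => v₀ c' * pinW δ' (ϖ ∘ posOut) c') 1 𝔅)‖ := rfl
        _ ≤ c₀ * ‖ι Y'‖ * M * ‖Z‖ := h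
        _ ≤ c₀ * ‖Y‖ * M * ‖Z‖ := by gcongr; exact (hιle Y').trans hY'n
        _ = c₀ * M * ‖Y‖ * ‖Z‖ := by ring
    have key := hconv.norm_image_sub_le_of_norm_hasFDerivWithin_le hf hbound
      (mem_closedBall_self (norm_nonneg Y)) (mem_closedBall_zero_iff.2 le_rfl)
    have h0 : ((WSup.toPiL (fun c => v₀ c * pinW δ' (ϖ ∘ posOut) c) 1).symm
        (D (WMax.toPiL (fun b => wt b * pinW δ' (ϖ ∘ posIn) b) wd Dv 0)) :
          WSup (fun c => v₀ c * pinW δ' (ϖ ∘ posOut) c) 1 𝔅) = 0 := by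
      rw [map_zero, hD0, map_zero]
    rw [h0, sub_zero, sub_zero] at key
    calc _ ≤ c₀ * M * ‖Y‖ * ‖Y‖ := key
      _ = c₀ * M * ‖Y‖ ^ 2 := by ring
  · have hmaps : MapsTo ι {Y | ‖Y‖ < r} {Y : WMax wt wd Dv | ‖Y‖ < r} := fun Y hY => (hιle Y).trans_lt hY
    have hcomp : DifferentiableOn ℂ (fun Y => D (WMax.toPiL wt wd Dv (ι Y))) {Y | ‖Y‖ < r} :=
      hWd.comp hιd.differentiableOn hmaps
    have e : (fun Y : WMax (fun b => wt b * pinW δ' (ϖ ∘ posIn) b) wd Dv =>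
        ((WSup.toPiL (fun c => v₀ c * pinW δ' (ϖ ∘ posOut) c) 1).symm
          (D (WMax.toPiL (fun b => wt b * pinW δ' (ϖ ∘ posIn) b) wd Dv Y)) :
            WSup (fun c => v₀ c * pinW δ' (ϖ ∘ posOut) c) 1 𝔅)) =
        (WSup.toPiL (fun c => v₀ c * pinW δ' (ϖ ∘ posOut) c) 1).symm ∘
          (fun Y => D (WMax.toPiL wt wd Dv (ι Y))) := rfl
    rw [e]
    exact (WSup.toPiL (𝔄 := 𝔅) (fun c => v₀ c * pinW δ' (ϖ ∘ posOut) c) 1).symm.differentiable.comp_differentiableOn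
      hcomp

/-- **THE `WMax`-WEIGHTED TWIN ON THE FINE TORUS, η-FREE (γ4) — the `Prop4Hyp.add` partner of S77 file 5's
`prop4Hyp_pinned_ord₃_eta_levels_torusPin` (at pin rate `δ′η`).**  Indices on `(ℤ∕Tℤ)^d` (`pos`, `pos′`; at most `m`
inputs per fine site), `ρ := pl1 (· − ·)`, the torus pin `pinDist B₀ hB₀` of ANY nonempty reference set at the FINE
rate `δ′η`; ONE weighted display with the CELL VOLUME in the entry, decay at rate `δη` per fine step, READ AT THE
`WMax` SIZE: `v₀ c·‖dker D (toPiL Y) c b‖ ≤ c₀·η^d·‖Y‖·wt b·e^{−(δη)·pl1(pos′ c − pos b)}`; `0 ≤ δ′ < δ`, `0 < η ≤ 1`,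
`1 ≤ d` ⟹ `Prop4Hyp D_pin (c₀·m·(2(d + (δ−δ′))∕(δ−δ′))^d) r` — NO `η`, NO `T`, NO `#B₀` (§2 with
`M := m·K₁ d ((δ−δ′)η)` from S66 f3a `sum_exp_pl1_comp_le`, then S79 `eta_pow_mul_K₁_le` and S65 f2c `Prop4Hyp.mono`).
[folklore] -/
theorem prop4Hyp_pinned_weighted_of_entry_decay_fineRate {d T : ℕ} [NeZero T] (pos : Λ → TPt d T)
    (pos' : Λ' → TPt d T) (B₀ : Finset (TPt d T)) (hB₀ : B₀.Nonempty) {m : ℕ}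
    (hm : ∀ x, (Finset.univ.filter fun b => pos b = x).card ≤ m) (hd : 0 < d)
    {D : (Λ → 𝔄) → (Λ' → 𝔅)} {r c₀ δ δ' η : ℝ} (hc₀ : 0 ≤ c₀) (hδ' : 0 ≤ δ') (hδ : δ' < δ) (hη : 0 < η)
    (hη1 : η ≤ 1) (hD0 : D 0 = 0)
    (hWd : DifferentiableOn ℂ (fun Y : WMax wt wd Dv => D (WMax.toPiL wt wd Dv Y)) {Y | ‖Y‖ < r})
    (hdec : ∀ Y : WMax wt wd Dv, ‖Y‖ < r → ∀ c b,
      v₀ c * ‖dker D (WMax.toPiL wt wd Dv Y) c b‖ ≤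
        c₀ * η ^ d * ‖Y‖ * wt b * Real.exp (-((δ * η) * pl1 (pos' c - pos b)))) :
    Prop4Hyp (fun Y : WMax (fun b => wt b * pinW (δ' * η) (pinDist B₀ hB₀ ∘ pos) b) wd Dv =>
        ((WSup.toPiL (fun c => v₀ c * pinW (δ' * η) (pinDist B₀ hB₀ ∘ pos') c) 1).symm
          (D (WMax.toPiL (fun b => wt b * pinW (δ' * η) (pinDist B₀ hB₀ ∘ pos) b) wd Dv Y)) :
            WSup (fun c => v₀ c * pinW (δ' * η) (pinDist B₀ hB₀ ∘ pos') c) 1 𝔅))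
      (c₀ * (m * (2 * (d + (δ - δ')) / (δ - δ')) ^ d)) r := by
  have hrate : 0 < δ - δ' := by linarith
  have hM : ∀ x : TPt d T, ∑ b, Real.exp (-((δ * η - δ' * η) * pl1 (x - pos b))) ≤ m * K₁ d ((δ - δ') * η) :=
    fun x => by
      have h := sum_exp_pl1_comp_le pos hm (mul_pos hrate hη) x
      simpa only [sub_mul] using h
  have hM0 : 0 ≤ (m : ℝ) * K₁ d ((δ - δ') * η) := mul_nonneg (Nat.cast_nonneg m) (K₁_nonneg _ _)
  have h := prop4Hyp_pinned_weighted_of_entry_decay wt wd Dv v₀ (fun x y : TPt d T => pl1 (x - y)) pos pos'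
    (pinDist B₀ hB₀) (c₀ := c₀ * η ^ d) (δ := δ * η) (δ' := δ' * η) (by positivity) (by positivity) hM0
    (pinDist_nonneg B₀ hB₀) (pinDist_le_add B₀ hB₀) hM hD0 hWd hdec
  refine Prop4Hyp.mono h ?_ le_rfl
  calc c₀ * η ^ d * (m * K₁ d ((δ - δ') * η)) = c₀ * (m * (η ^ d * K₁ d ((δ - δ') * η))) := by ring
    _ ≤ c₀ * (m * (2 * (d + (δ - δ')) / (δ - δ')) ^ d) :=
        mul_le_mul_of_nonneg_left (mul_le_mul_of_nonneg_left (eta_pow_mul_K₁_le hd hrate hη hη1)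
          (Nat.cast_nonneg m)) hc₀

end Weighted

/-! ## §3 Non-vacuity -/

section Toy

/-- NON-VACUITY of §2 (trigger c3): the ZERO letter on one-point index sets, unit weights, `Dv = 0`, `c₀ = 0`, `M = 1`,
`r = 1`, `δ = δ′ = 0`, pin `ϖ ≡ 0`, `ρ ≡ 0`. [folklore] -/
example :
    Prop4Hyp (fun Y : WMax (fun b : Unit => (fun _ : Unit => (1 : ℝ)) b *
          pinW (0 : ℝ) ((fun _ : Unit => (0 : ℝ)) ∘ fun _ : Unit => ()) b)
        (fun _ : Unit => (1 : ℝ)) (0 : (Unit → ℂ) →L[ℂ] (Unit → ℂ)) =>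
      ((WSup.toPiL (fun c : Unit => (fun _ : Unit => (1 : ℝ)) c *
            pinW (0 : ℝ) ((fun _ : Unit => (0 : ℝ)) ∘ fun _ : Unit => ()) c) 1).symm
        ((fun _ : Unit → ℂ => (0 : Unit → ℂ))
          (WMax.toPiL (fun b : Unit => (fun _ : Unit => (1 : ℝ)) b *
              pinW (0 : ℝ) ((fun _ : Unit => (0 : ℝ)) ∘ fun _ : Unit => ()) b)
            (fun _ : Unit => (1 : ℝ)) (0 : (Unit → ℂ) →L[ℂ] (Unit → ℂ)) Y)) :
        WSup (fun c : Unit => (fun _ : Unit => (1 : ℝ)) c *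
          pinW (0 : ℝ) ((fun _ : Unit => (0 : ℝ)) ∘ fun _ : Unit => ()) c) 1 ℂ))
      (0 * 1) 1 :=
  prop4Hyp_pinned_weighted_of_entry_decay (S := Unit) (fun _ : Unit => (1 : ℝ)) (fun _ : Unit => (1 : ℝ))
    (0 : (Unit → ℂ) →L[ℂ] (Unit → ℂ)) (fun _ : Unit => (1 : ℝ)) (fun _ _ => 0) (fun _ => ()) (fun _ => ())
    (fun _ => 0) (r := 1) (δ := 0) le_rfl le_rfl zero_le_one (fun _ => le_rfl) (fun _ _ => by simp) (fun _ => by simp) rfl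
    (differentiableOn_const _)
    (fun Y _ c b => by
      have h : dker (fun _ : Unit → ℂ => (0 : Unit → ℂ))
          (WMax.toPiL (fun _ : Unit => (1 : ℝ)) (fun _ : Unit => (1 : ℝ)) (0 : (Unit → ℂ) →L[ℂ] (Unit → ℂ)) Y)
          c b = 0 := by
        ext; simp [dker_apply]
      rw [h, norm_zero, mul_zero]; positivity)

/-- NON-VACUITY of §1 (rule G-1): the one-site torus `(ℤ∕1ℤ)^1`, index at `0`, `B₀ = {0}`, the ZERO letter, `c₀ = 0`,
`δ = 1`, `δ′ = 0`, `η = 1`, `m = 1`, `r = 1` — every binder of `prop4Hyp_pinned_of_entry_decay_eta` jointly inhabited. [folklore] -/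
example :
    Prop4Hyp (fun Y : WSup (pinW (0 : ℝ) ((fun x : TPt 1 1 => (1 : ℝ) * pinDist ({0} : Finset (TPt 1 1))
          (Finset.singleton_nonempty 0) x) ∘ fun _ : Unit => (0 : TPt 1 1))) 1 ℂ =>
        ((WSup.toPiL (pinW (0 : ℝ) ((fun x : TPt 1 1 => (1 : ℝ) * pinDist ({0} : Finset (TPt 1 1))
            (Finset.singleton_nonempty 0) x) ∘ fun _ : Unit => (0 : TPt 1 1))) 1).symm
          ((fun _ : Unit → ℂ => (0 : Unit → ℂ))
            (WSup.toPiL (pinW (0 : ℝ) ((fun x : TPt 1 1 => (1 : ℝ) * pinDist ({0} : Finset (TPt 1 1))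
              (Finset.singleton_nonempty 0) x) ∘ fun _ : Unit => (0 : TPt 1 1))) 1 Y)) :
          WSup (pinW (0 : ℝ) ((fun x : TPt 1 1 => (1 : ℝ) * pinDist ({0} : Finset (TPt 1 1))
            (Finset.singleton_nonempty 0) x) ∘ fun _ : Unit => (0 : TPt 1 1))) 1 ℂ))
      (0 * ((1 : ℕ) * (2 * ((1 : ℕ) + ((1 : ℝ) - 0)) / ((1 : ℝ) - 0)) ^ (1 : ℕ))) 1 :=
  prop4Hyp_pinned_of_entry_decay_eta (fun _ : Unit => (0 : TPt 1 1)) (fun _ : Unit => (0 : TPt 1 1))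
    ({0} : Finset (TPt 1 1)) (Finset.singleton_nonempty 0) (m := 1)
    (fun x => (Finset.card_filter_le _ _).trans (by simp)) Nat.one_pos (D := fun _ : Unit → ℂ => (0 : Unit → ℂ))
    (r := 1) (c₀ := 0) (δ := 1) (δ' := 0) (η := 1) le_rfl le_rfl zero_lt_one one_pos le_rfl
    (differentiableOn_const _) rfl
    (fun A _ c b => by
      have h : dker (fun _ : Unit → ℂ => (0 : Unit → ℂ)) A c b = 0 := by ext; simp [dker_apply]
      rw [h, norm_zero]; positivity)

end Toy

end Summit.QuantumFields.BalabanUV.T4Continuum.ShellMeasureGradientPinnedDecayLevels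

end
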